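import Summits.QuantumFields.BalabanUV.Beta.CombMixedT2EvenGradedLetters

/-!
# `BalabanUV.Beta.CombMixedT2EvenGradedRec` — binder row D1 ∕ (C1), PART 78b: **(K2b) FOR THE GRADED COMPOSITE MIXED KERNEL IS THE DISPLAYED COMMUTATOR AT EVERY DEPTH** —
# for an1's (0.4)-SYM bricks at the centred root at all levels, every depth `m`, every level-`m` bond `(μ,y)`, finest bonds `f, f′`, gauge function `λ`,
# `Σ'_x Σ_α (λ(x+e_α) − λ x)·½(compMixKerG_m(μ,y;(α,x),f,f′) + compMixKerG_m(…,f′,f)) = (λ(x_{f′}) − λ(x_f)) · compVHKer ℓ 𝒽 Lc m (μ,y) f f′`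
# — the single FINEST commutator with the depth-`m` composite Hessian: NO storey term, NO root sampling (contrast PART 30∕32: F6c's `compMixKer` is STOREYWISE)

WHY (journal [AN2-G81-ONLINE] J-NOTE-26 §1; memo `HOME/b2b-balaban-beta-an2/gen81/J26-GRADED-K2B.md`).  (F0) `CompositeMixedTableGraded` (p735020): `compMixKerG (m+1) = S1 + S2 − S3
+ S4 + Σ ℓ·compMixKerG m` — F6c's recursion with the third summand's sign flipped, the object Engine C's locator says v10's `a2` is inhabited by (A2-LOCATE.md 547291ba LINE 1).
PART 30∕32 proved that F6c's `compMixKer` (cross words `S2 + S3`, `(f,f′)`-odd, absent from the even half) obeys the STOREYWISE Ward recursion — the top storey's commutator carries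
the gauge function sampled at the level-`m` block ROOTS between the transports — and that the «displayed single-generator form `κ₂·[E_λ, compH₂]`» does NOT hold (K2L-V-A by value
0.06–0.75).  For the GRADED kernel the even half KEEPS the symmetric cross pairing `S2 + S2ˢʷᵃᵖ` (PART 78a `compMixKerG_succ_even_eq`); its own gauge row — (W-vh)_m on the lower
composite mixed vertex, PART 78a `tsum_sum_grad_mul_compVHKer`, on both copies, the swapped one re-indexed under `symHessKerAt_swap` — is
`Σ_{b₁,b₂} 𝒽(μ,y;b₁,b₂)·cL_m(f;b₁)·cL_m(f′;b₂)·[(λ(R_m b₁.2) − λ(R_m b₂.2)) + (λ(x_{f′}) − λ(x_f))]`: the first bracket CANCELS PART 32's root-sampled top storey EXACTLY, the second is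
the finest commutator of the top word of `compVHKer ℓ 𝒽 (m+1)` (F3 `compVHKer_succ`); the `ℓ`-sector carries the depth-`m` identity; induction closes the displayed form.  So the graded
table is the one whose (K2b) is that of a genuine third derivative of a gauge-covariant composite — the lattice companion (no torus, no `p`, no `μ`, no float) of Engine C's (P5).
This is (F1)'s FIRST LEMMA of the row's [AN2-G80-RCPT-10] (4) design (v11's `hM₂′ := compMixG`); the torus periodisation is PART 26∕31's engine applied to ONE commutator — next.

WHAT (`d = 3`, centred root `ρ_c = ctr 4 Lc`, sym bricks constant in the level; [folklore] finite re-indexing and one induction BY NAME over PART 78a's letters and PART 32's (W-lin)_m ∕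
site law; no `def`, no `def … : Prop`, nothing cited, 0 sorry):
`sum4_cross_swap_eq_neg` (the swapped cross row re-indexed under `symHessKerAt_swap`), **`tsum_sum_grad_mul_compMixKerG_even`** (the display above, every depth `m`).
WHAT THIS IS NOT: not the torus periodisation (next); not v11's `a2` row nor its display (the road's); not a statement about `compMixKer` (PART 30∕32 stand: its even half is
storeywise); nothing of Bałaban's asserted, valued or discharged (the graded sign is in OUR chain rule for OUR transcription — whether Bałaban's own mixed table carries the symmetric
cross pairing is not a question this tree can put — ABSOLUTE RULE); 0 estimates; 0∕4 row-D1 binders (hW, hR, D1Tel, D1Rep); ROOT M‴ p325680 ∕ P5c ∕ D6 untouched; NOT (C1),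
NOT (T-ID), NOT D1, NEVER «G-an2-4 closed», NOT BetaPertH, NOT continuum, NOT Clay.

HONEST DEPENDENCY (page 1, mandatory): continuum YM on T⁴ ⇐ BetaPertH ∧ nine spine estimates (0/9 proved); BetaPertH ⇐ (D1) ∧ (D4) ∧ CAP+tail;
G-an2-4 gates asym, D1 and NE2/3/4.  HONEST FRAMING (cell contract, verbatim): «discharging `BetaPertH` makes Bałaban's UV stability UNCONDITIONAL —
a real constructive-QFT result; it is NOT the continuum limit and NOT the Clay problem.»  ABSOLUTE RULE (cell charter, verbatim): «No internally-minted
statement may enter as a cited fact. Every hypothesis is either kernel-proved in this package or a verbatim quotation of a PUBLISHED theorem with page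
reference. The manuscript(s) under audit are NOT citable for their own disputed steps — they are the thing under adjudication; programme-internal
(2001/route/tribunal) claims are never citable.»  Row D1 ∕ (C1) OWNER an2 (b2b-balaban-beta-an2) gen 81, 2026-08-29.  Proof skeleton = PART 32 §3 (one sector more).
No existing file touched.
-/

noncomputable section

open scoped BigOperators

namespace Summit.QuantumFields.BalabanUV.Beta.CombMixedT2EvenGradedRec

open Finset
open Literature.MathematicalPhysics.QuantumFieldTheory
open Literature.MathematicalPhysics.QuantumFieldTheory.Balaban1983to89
open Literature.MathematicalPhysics.QuantumFieldTheory.Balaban1983to89.Beta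
open AffineAveraging (Site box toSite unitVec dz)
open AveragingContoursRooted (ctr ctrOff ctrOff_mem_box)
open AveragingHessianKernels (Bond Near)
open Summit.QuantumFields.BalabanUV.Beta.AxialDressingRooted (one_le_of_neZero)
open Summit.QuantumFields.BalabanUV.Beta.SymAveragingHessianCounts (symLinKerAt symVhKerAt symHessKerAt symHessKerAt_swap symLinKerAt_eq_zero symVhKerAt_eq_zero_right)
open Summit.QuantumFields.BalabanUV.Beta.SymAveragingMixedJetTables (symMixKerAt)
open Summit.QuantumFields.BalabanUV.Beta.SymAveragingWardRootedStencils (symVhKerAt_div_right)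
open Summit.QuantumFields.BalabanUV.Beta.CompositeVertexKernelRec (offs winF wid compLinKer compVHKer compLinKer_succ compLinKer_zero compVHKer_zero compVHKer_succ
  compLinKer_eq_zero compVHKer_eq_zero_right near_iff_exists_offs mem_winF_succ_of_offs)
open Summit.QuantumFields.BalabanUV.Beta.CompositeMixedTableGraded (compMixKerG compMixKerG_zero compMixKerG_succ)
open Summit.QuantumFields.BalabanUV.Beta.GAN24.BorderGaugeLegContact (tsum_sum_dz_mul_eq tsum_mul_ite_sub_ite_mul)
open Summit.QuantumFields.BalabanUV.Beta.CombMixedT2EvenStoreyTwoLetters (tsum_eq_sum_offs sum4_swap sum4_eq_zero_of_add4 sum6_push2)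
open Summit.QuantumFields.BalabanUV.Beta.CombMixedT2EvenStoreyTwo (tsum_sum_grad_mul_symLinKerAt)
open Summit.QuantumFields.BalabanUV.Beta.CombMixedT2EvenStoreyRec (tsum_sum_grad_mul_compLinKer sum_offs_grad_mul_symMixKerAt_even even_S23_eq_zero even_S4_eq_zero)
open Summit.QuantumFields.BalabanUV.Beta.CombMixedT2EvenGradedLetters (compMixKerG_eq_zero_bg tsum_sum_grad_mul_compVHKer compMixKerG_succ_even_eq)

variable {Lc : ℕ} [NeZero Lc]

/-! ## §3 The displayed commutator at every depth -/

omit [NeZero Lc] in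
/-- [folklore] THE SWAPPED CROSS ROW RE-INDEXED: exchanging the bond pair and using `symHessKerAt_swap`,
`Σ_{b₁,b₂} 𝒽(b₁,b₂)·cL(f;b₂)·(Φ(b₁) · cL(f′;b₁)) = −Σ_{b₁,b₂} 𝒽(b₁,b₂)·cL(f;b₁)·cL(f′;b₂)·Φ(b₂)` for any per-bond scalar `Φ`. -/
theorem sum4_cross_swap_eq_neg (Φ : Fin (3 + 1) → Site (3 + 1) → ℝ) (m : ℕ) (μ : Fin (3 + 1)) (y : Site (3 + 1)) (f f' : Bond (3 + 1)) :
    (∑ κ₁ : Fin (3 + 1), ∑ e₁ ∈ offs Lc, ∑ κ₂ : Fin (3 + 1), ∑ e₂ ∈ offs Lc,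
        symHessKerAt (ctr 4 Lc) Lc μ y (κ₁, (Lc : ℤ) • y + e₁) (κ₂, (Lc : ℤ) • y + e₂)
          * compLinKer (fun _ => symLinKerAt (ctr 4 Lc) Lc) Lc m f (κ₂, (Lc : ℤ) • y + e₂)
          * (Φ κ₁ e₁ * compLinKer (fun _ => symLinKerAt (ctr 4 Lc) Lc) Lc m f' (κ₁, (Lc : ℤ) • y + e₁)))
      = -(∑ κ₁ : Fin (3 + 1), ∑ e₁ ∈ offs Lc, ∑ κ₂ : Fin (3 + 1), ∑ e₂ ∈ offs Lc,
          symHessKerAt (ctr 4 Lc) Lc μ y (κ₁, (Lc : ℤ) • y + e₁) (κ₂, (Lc : ℤ) • y + e₂)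
            * compLinKer (fun _ => symLinKerAt (ctr 4 Lc) Lc) Lc m f (κ₁, (Lc : ℤ) • y + e₁)
            * compLinKer (fun _ => symLinKerAt (ctr 4 Lc) Lc) Lc m f' (κ₂, (Lc : ℤ) • y + e₂) * Φ κ₂ e₂) := by
  rw [sum4_swap (fun κ₁ e₁ κ₂ e₂ => symHessKerAt (ctr 4 Lc) Lc μ y (κ₁, (Lc : ℤ) • y + e₁) (κ₂, (Lc : ℤ) • y + e₂)
          * compLinKer (fun _ => symLinKerAt (ctr 4 Lc) Lc) Lc m f (κ₂, (Lc : ℤ) • y + e₂)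
          * (Φ κ₁ e₁ * compLinKer (fun _ => symLinKerAt (ctr 4 Lc) Lc) Lc m f' (κ₁, (Lc : ℤ) • y + e₁)))]
  simp only [← Finset.sum_neg_distrib]
  refine Finset.sum_congr rfl fun κ₁ _ => Finset.sum_congr rfl fun e₁ _ => Finset.sum_congr rfl fun κ₂ _ => Finset.sum_congr rfl fun e₂ _ => ?_
  rw [symHessKerAt_swap (ctr 4 Lc) Lc μ y (κ₁, (Lc : ℤ) • y + e₁) (κ₂, (Lc : ℤ) • y + e₂)]
  ring

/-- [folklore] **`tsum_sum_grad_mul_compMixKerG_even` — (K2b) FOR THE GRADED COMPOSITE MIXED KERNEL IS THE DISPLAYED COMMUTATOR, EVERY DEPTH**: for an1's (0.4)-SYM bricks at the centred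
root at all levels, every depth `m`, every level-`m` bond `(μ, y)`, every pair of finest bonds `f, f′` and every gauge function `λ`,
`Σ'_x Σ_α (λ(x+e_α) − λ x)·½(compMixKerG_m(μ,y;(α,x),f,f′) + compMixKerG_m(μ,y;(α,x),f′,f)) = (λ(f′.2) − λ(f.2)) · compVHKer ℓ 𝒽 Lc m μ y f f′`
— the single FINEST commutator with the depth-`m` composite Hessian `compVHKer ℓ 𝒽` (the «displayed single-generator form» of PART 30's header, `γ = −1`); NO storey term.
Induction over §2: the S1 sector is PART 32's top storey ((W-lin)_m + the site law at level `m` with `λ∘R_m`), the cross sector is (W-vh)_m (§1) on both copies — its root-sampled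
part CANCELS the top storey, its finest part is the commutator of `compVHKer ℓ 𝒽 (m+1)`'s top word (`compVHKer_succ`) — and the `ℓ`-sector carries the depth-`m` identity. -/
theorem tsum_sum_grad_mul_compMixKerG_even (lam : Site (3 + 1) → ℝ) : ∀ (m : ℕ) (μ : Fin (3 + 1)) (y : Site (3 + 1)) (f f' : Bond (3 + 1)),
    ∑' x : Site (3 + 1), ∑ α : Fin (3 + 1), (lam (x + unitVec α) - lam x)
        * ((1 / 2 : ℝ) * (compMixKerG (fun _ => symLinKerAt (ctr 4 Lc) Lc) (fun _ => symVhKerAt (ctr 4 Lc) Lc) (fun _ => symHessKerAt (ctr 4 Lc) Lc)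
              (fun _ => symMixKerAt (ctr 4 Lc) Lc) Lc m μ y (α, x) f f'
            + compMixKerG (fun _ => symLinKerAt (ctr 4 Lc) Lc) (fun _ => symVhKerAt (ctr 4 Lc) Lc) (fun _ => symHessKerAt (ctr 4 Lc) Lc)
              (fun _ => symMixKerAt (ctr 4 Lc) Lc) Lc m μ y (α, x) f' f))
      = (lam f'.2 - lam f.2)
        * compVHKer (fun _ => symLinKerAt (ctr 4 Lc) Lc) (fun _ => symHessKerAt (ctr 4 Lc) Lc) Lc m μ y f f'
  | 0, μ, y, f, f' => by
      simp only [compMixKerG_zero, compVHKer_zero, add_zero, mul_zero, Finset.sum_const_zero, tsum_zero]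
  | m + 1, μ, y, f, f' => by
      have hLc : 1 ≤ Lc := one_le_of_neZero Lc
      have IH := tsum_sum_grad_mul_compMixKerG_even lam m
      -- the top-storey integrand per window bond `b = (κ, Lc•y + e)` (PART 32's `C`)
      set C : Fin (3 + 1) → Site (3 + 1) → ℝ := fun κ e => (1 / 2 : ℝ) * ∑ κ₁ : Fin (3 + 1), ∑ e₁ ∈ offs Lc, ∑ κ₂ : Fin (3 + 1), ∑ e₂ ∈ offs Lc,
          (symMixKerAt (ctr 4 Lc) Lc μ y (κ, (Lc : ℤ) • y + e) (κ₁, (Lc : ℤ) • y + e₁) (κ₂, (Lc : ℤ) • y + e₂)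
            + symMixKerAt (ctr 4 Lc) Lc μ y (κ, (Lc : ℤ) • y + e) (κ₂, (Lc : ℤ) • y + e₂) (κ₁, (Lc : ℤ) • y + e₁))
            * compLinKer (fun _ => symLinKerAt (ctr 4 Lc) Lc) Lc m f (κ₁, (Lc : ℤ) • y + e₁)
            * compLinKer (fun _ => symLinKerAt (ctr 4 Lc) Lc) Lc m f' (κ₂, (Lc : ℤ) • y + e₂) with hC
      -- (pointwise) the even integrand splits into the S1 sector, the two cross rows and the S5 sector
      have hsplit : ∀ x : Site (3 + 1), (∑ α : Fin (3 + 1), (lam (x + unitVec α) - lam x)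
            * ((1 / 2 : ℝ) * (compMixKerG (fun _ => symLinKerAt (ctr 4 Lc) Lc) (fun _ => symVhKerAt (ctr 4 Lc) Lc) (fun _ => symHessKerAt (ctr 4 Lc) Lc)
                  (fun _ => symMixKerAt (ctr 4 Lc) Lc) Lc (m + 1) μ y (α, x) f f'
                + compMixKerG (fun _ => symLinKerAt (ctr 4 Lc) Lc) (fun _ => symVhKerAt (ctr 4 Lc) Lc) (fun _ => symHessKerAt (ctr 4 Lc) Lc)
                  (fun _ => symMixKerAt (ctr 4 Lc) Lc) Lc (m + 1) μ y (α, x) f' f)))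
          = (∑ κ : Fin (3 + 1), ∑ e ∈ offs Lc, (∑ α : Fin (3 + 1), (lam (x + unitVec α) - lam x)
                * compLinKer (fun _ => symLinKerAt (ctr 4 Lc) Lc) Lc m (α, x) (κ, (Lc : ℤ) • y + e)) * C κ e)
            + ((∑ κ₁ : Fin (3 + 1), ∑ e₁ ∈ offs Lc, ∑ κ₂ : Fin (3 + 1), ∑ e₂ ∈ offs Lc,
                  symHessKerAt (ctr 4 Lc) Lc μ y (κ₁, (Lc : ℤ) • y + e₁) (κ₂, (Lc : ℤ) • y + e₂)
                    * compLinKer (fun _ => symLinKerAt (ctr 4 Lc) Lc) Lc m f' (κ₂, (Lc : ℤ) • y + e₂)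
                    * ∑ α : Fin (3 + 1), (lam (x + unitVec α) - lam x)
                        * compVHKer (fun _ => symLinKerAt (ctr 4 Lc) Lc) (fun _ => symVhKerAt (ctr 4 Lc) Lc) Lc m κ₁ ((Lc : ℤ) • y + e₁) f (α, x))
              + (∑ κ₁ : Fin (3 + 1), ∑ e₁ ∈ offs Lc, ∑ κ₂ : Fin (3 + 1), ∑ e₂ ∈ offs Lc,
                  symHessKerAt (ctr 4 Lc) Lc μ y (κ₁, (Lc : ℤ) • y + e₁) (κ₂, (Lc : ℤ) • y + e₂)
                    * compLinKer (fun _ => symLinKerAt (ctr 4 Lc) Lc) Lc m f (κ₂, (Lc : ℤ) • y + e₂)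
                    * ∑ α : Fin (3 + 1), (lam (x + unitVec α) - lam x)
                        * compVHKer (fun _ => symLinKerAt (ctr 4 Lc) Lc) (fun _ => symVhKerAt (ctr 4 Lc) Lc) Lc m κ₁ ((Lc : ℤ) • y + e₁) f' (α, x)))
            + ∑ κ : Fin (3 + 1), ∑ e ∈ offs Lc, symLinKerAt (ctr 4 Lc) Lc μ y (κ, (Lc : ℤ) • y + e)
                * ∑ α : Fin (3 + 1), (lam (x + unitVec α) - lam x)
                    * ((1 / 2 : ℝ) * (compMixKerG (fun _ => symLinKerAt (ctr 4 Lc) Lc) (fun _ => symVhKerAt (ctr 4 Lc) Lc) (fun _ => symHessKerAt (ctr 4 Lc) Lc)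
                          (fun _ => symMixKerAt (ctr 4 Lc) Lc) Lc m κ ((Lc : ℤ) • y + e) (α, x) f f'
                        + compMixKerG (fun _ => symLinKerAt (ctr 4 Lc) Lc) (fun _ => symVhKerAt (ctr 4 Lc) Lc) (fun _ => symHessKerAt (ctr 4 Lc) Lc)
                          (fun _ => symMixKerAt (ctr 4 Lc) Lc) Lc m κ ((Lc : ℤ) • y + e) (α, x) f' f)) := fun x => by
        have pull1 : (∑ α : Fin (3 + 1), (lam (x + unitVec α) - lam x)
              * ((1 / 2 : ℝ) * ∑ κ : Fin (3 + 1), ∑ e ∈ offs Lc, ∑ κ₁ : Fin (3 + 1), ∑ e₁ ∈ offs Lc, ∑ κ₂ : Fin (3 + 1), ∑ e₂ ∈ offs Lc,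
                (symMixKerAt (ctr 4 Lc) Lc μ y (κ, (Lc : ℤ) • y + e) (κ₁, (Lc : ℤ) • y + e₁) (κ₂, (Lc : ℤ) • y + e₂)
                  + symMixKerAt (ctr 4 Lc) Lc μ y (κ, (Lc : ℤ) • y + e) (κ₂, (Lc : ℤ) • y + e₂) (κ₁, (Lc : ℤ) • y + e₁))
                  * compLinKer (fun _ => symLinKerAt (ctr 4 Lc) Lc) Lc m (α, x) (κ, (Lc : ℤ) • y + e)
                  * compLinKer (fun _ => symLinKerAt (ctr 4 Lc) Lc) Lc m f (κ₁, (Lc : ℤ) • y + e₁)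
                  * compLinKer (fun _ => symLinKerAt (ctr 4 Lc) Lc) Lc m f' (κ₂, (Lc : ℤ) • y + e₂)))
            = ∑ κ : Fin (3 + 1), ∑ e ∈ offs Lc, (∑ α : Fin (3 + 1), (lam (x + unitVec α) - lam x)
                * compLinKer (fun _ => symLinKerAt (ctr 4 Lc) Lc) Lc m (α, x) (κ, (Lc : ℤ) • y + e)) * C κ e := by
          simp only [hC]
          simp only [Finset.sum_mul]
          simp only [Finset.mul_sum]
          refine Finset.sum_comm.trans (Finset.sum_congr rfl fun κ _ => Finset.sum_comm.trans (Finset.sum_congr rfl fun e _ =>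
            Finset.sum_congr rfl fun α _ => Finset.sum_congr rfl fun κ₁ _ => Finset.sum_congr rfl fun e₁ _ => Finset.sum_congr rfl fun κ₂ _ =>
            Finset.sum_congr rfl fun e₂ _ => ?_))
          ring
        have pull2 : ∀ f₁ f₂ : Bond (3 + 1), (∑ α : Fin (3 + 1), (lam (x + unitVec α) - lam x)
              * ∑ κ₁ : Fin (3 + 1), ∑ e₁ ∈ offs Lc, ∑ κ₂ : Fin (3 + 1), ∑ e₂ ∈ offs Lc,
                symHessKerAt (ctr 4 Lc) Lc μ y (κ₁, (Lc : ℤ) • y + e₁) (κ₂, (Lc : ℤ) • y + e₂)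
                  * compVHKer (fun _ => symLinKerAt (ctr 4 Lc) Lc) (fun _ => symVhKerAt (ctr 4 Lc) Lc) Lc m κ₁ ((Lc : ℤ) • y + e₁) f₁ (α, x)
                  * compLinKer (fun _ => symLinKerAt (ctr 4 Lc) Lc) Lc m f₂ (κ₂, (Lc : ℤ) • y + e₂))
            = ∑ κ₁ : Fin (3 + 1), ∑ e₁ ∈ offs Lc, ∑ κ₂ : Fin (3 + 1), ∑ e₂ ∈ offs Lc,
                symHessKerAt (ctr 4 Lc) Lc μ y (κ₁, (Lc : ℤ) • y + e₁) (κ₂, (Lc : ℤ) • y + e₂)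
                  * compLinKer (fun _ => symLinKerAt (ctr 4 Lc) Lc) Lc m f₂ (κ₂, (Lc : ℤ) • y + e₂)
                  * ∑ α : Fin (3 + 1), (lam (x + unitVec α) - lam x)
                      * compVHKer (fun _ => symLinKerAt (ctr 4 Lc) Lc) (fun _ => symVhKerAt (ctr 4 Lc) Lc) Lc m κ₁ ((Lc : ℤ) • y + e₁) f₁ (α, x) := by
          intro f₁ f₂
          simp only [Finset.mul_sum]
          refine Finset.sum_comm.trans (Finset.sum_congr rfl fun κ₁ _ => Finset.sum_comm.trans (Finset.sum_congr rfl fun e₁ _ =>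
            Finset.sum_comm.trans (Finset.sum_congr rfl fun κ₂ _ => Finset.sum_comm.trans (Finset.sum_congr rfl fun e₂ _ =>
            Finset.sum_congr rfl fun α _ => ?_))))
          ring
        have pull5 : (∑ α : Fin (3 + 1), (lam (x + unitVec α) - lam x)
              * ((1 / 2 : ℝ) * ∑ κ : Fin (3 + 1), ∑ e ∈ offs Lc, symLinKerAt (ctr 4 Lc) Lc μ y (κ, (Lc : ℤ) • y + e)
                * (compMixKerG (fun _ => symLinKerAt (ctr 4 Lc) Lc) (fun _ => symVhKerAt (ctr 4 Lc) Lc) (fun _ => symHessKerAt (ctr 4 Lc) Lc)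
                      (fun _ => symMixKerAt (ctr 4 Lc) Lc) Lc m κ ((Lc : ℤ) • y + e) (α, x) f f'
                  + compMixKerG (fun _ => symLinKerAt (ctr 4 Lc) Lc) (fun _ => symVhKerAt (ctr 4 Lc) Lc) (fun _ => symHessKerAt (ctr 4 Lc) Lc)
                      (fun _ => symMixKerAt (ctr 4 Lc) Lc) Lc m κ ((Lc : ℤ) • y + e) (α, x) f' f)))
            = ∑ κ : Fin (3 + 1), ∑ e ∈ offs Lc, symLinKerAt (ctr 4 Lc) Lc μ y (κ, (Lc : ℤ) • y + e)
                * ∑ α : Fin (3 + 1), (lam (x + unitVec α) - lam x)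
                    * ((1 / 2 : ℝ) * (compMixKerG (fun _ => symLinKerAt (ctr 4 Lc) Lc) (fun _ => symVhKerAt (ctr 4 Lc) Lc) (fun _ => symHessKerAt (ctr 4 Lc) Lc)
                          (fun _ => symMixKerAt (ctr 4 Lc) Lc) Lc m κ ((Lc : ℤ) • y + e) (α, x) f f'
                        + compMixKerG (fun _ => symLinKerAt (ctr 4 Lc) Lc) (fun _ => symVhKerAt (ctr 4 Lc) Lc) (fun _ => symHessKerAt (ctr 4 Lc) Lc)
                          (fun _ => symMixKerAt (ctr 4 Lc) Lc) Lc m κ ((Lc : ℤ) • y + e) (α, x) f' f)) := by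
          simp only [Finset.mul_sum]
          refine Finset.sum_comm.trans (Finset.sum_congr rfl fun κ _ => Finset.sum_comm.trans (Finset.sum_congr rfl fun e _ =>
            Finset.sum_congr rfl fun α _ => ?_))
          ring
        rw [← pull1, ← pull2 f f', ← pull2 f' f, ← pull5, ← Finset.sum_add_distrib, ← Finset.sum_add_distrib, ← Finset.sum_add_distrib]
        refine Finset.sum_congr rfl fun α _ => ?_
        rw [compMixKerG_succ_even_eq]
        ring
      -- summability of the four pieces (finite support in the finest site `x`)
      have hs1 : ∀ (κ : Fin (3 + 1)) (e : Site (3 + 1)), Summable fun x : Site (3 + 1) =>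
          (∑ α : Fin (3 + 1), (lam (x + unitVec α) - lam x) * compLinKer (fun _ => symLinKerAt (ctr 4 Lc) Lc) Lc m (α, x) (κ, (Lc : ℤ) • y + e)) * C κ e := fun κ e =>
        summable_of_ne_finset_zero (s := winF (Lc ^ m) (wid Lc m) ((Lc : ℤ) • y + e)) fun x hx => by
          rw [Finset.sum_eq_zero fun α _ => ?_, zero_mul]
          rw [compLinKer_eq_zero m (f := (α, x)) (g := (κ, (Lc : ℤ) • y + e)) hx, mul_zero]
      have hs2 : ∀ (f₁ f₂ : Bond (3 + 1)) (κ₁ : Fin (3 + 1)) (e₁ : Site (3 + 1)) (κ₂ : Fin (3 + 1)) (e₂ : Site (3 + 1)), Summable fun x : Site (3 + 1) =>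
          symHessKerAt (ctr 4 Lc) Lc μ y (κ₁, (Lc : ℤ) • y + e₁) (κ₂, (Lc : ℤ) • y + e₂)
            * compLinKer (fun _ => symLinKerAt (ctr 4 Lc) Lc) Lc m f₂ (κ₂, (Lc : ℤ) • y + e₂)
            * ∑ α : Fin (3 + 1), (lam (x + unitVec α) - lam x)
                * compVHKer (fun _ => symLinKerAt (ctr 4 Lc) Lc) (fun _ => symVhKerAt (ctr 4 Lc) Lc) Lc m κ₁ ((Lc : ℤ) • y + e₁) f₁ (α, x) :=
        fun f₁ f₂ κ₁ e₁ κ₂ e₂ => summable_of_ne_finset_zero (s := winF (Lc ^ m) (wid Lc m) ((Lc : ℤ) • y + e₁)) fun x hx => by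
          rw [Finset.sum_eq_zero fun α _ => ?_, mul_zero]
          rw [compVHKer_eq_zero_right m f₁ (f' := (α, x)) hx, mul_zero]
      have hs5 : ∀ (κ : Fin (3 + 1)) (e : Site (3 + 1)), Summable fun x : Site (3 + 1) =>
          symLinKerAt (ctr 4 Lc) Lc μ y (κ, (Lc : ℤ) • y + e)
            * ∑ α : Fin (3 + 1), (lam (x + unitVec α) - lam x)
                * ((1 / 2 : ℝ) * (compMixKerG (fun _ => symLinKerAt (ctr 4 Lc) Lc) (fun _ => symVhKerAt (ctr 4 Lc) Lc) (fun _ => symHessKerAt (ctr 4 Lc) Lc)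
                      (fun _ => symMixKerAt (ctr 4 Lc) Lc) Lc m κ ((Lc : ℤ) • y + e) (α, x) f f'
                    + compMixKerG (fun _ => symLinKerAt (ctr 4 Lc) Lc) (fun _ => symVhKerAt (ctr 4 Lc) Lc) (fun _ => symHessKerAt (ctr 4 Lc) Lc)
                      (fun _ => symMixKerAt (ctr 4 Lc) Lc) Lc m κ ((Lc : ℤ) • y + e) (α, x) f' f)) := fun κ e =>
        summable_of_ne_finset_zero (s := winF (Lc ^ m) (wid Lc m) ((Lc : ℤ) • y + e)) fun x hx => by
          rw [Finset.sum_eq_zero fun α _ => ?_, mul_zero]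
          rw [compMixKerG_eq_zero_bg m (g := (α, x)) f f' hx, compMixKerG_eq_zero_bg m (g := (α, x)) f' f hx, add_zero, mul_zero, mul_zero]
      have hS1 : Summable fun x : Site (3 + 1) => ∑ κ : Fin (3 + 1), ∑ e ∈ offs Lc,
          (∑ α : Fin (3 + 1), (lam (x + unitVec α) - lam x) * compLinKer (fun _ => symLinKerAt (ctr 4 Lc) Lc) Lc m (α, x) (κ, (Lc : ℤ) • y + e)) * C κ e :=
        summable_sum fun κ _ => summable_sum fun e _ => hs1 κ e
      have hS2 : ∀ f₁ f₂ : Bond (3 + 1), Summable fun x : Site (3 + 1) => ∑ κ₁ : Fin (3 + 1), ∑ e₁ ∈ offs Lc, ∑ κ₂ : Fin (3 + 1), ∑ e₂ ∈ offs Lc,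
          symHessKerAt (ctr 4 Lc) Lc μ y (κ₁, (Lc : ℤ) • y + e₁) (κ₂, (Lc : ℤ) • y + e₂)
            * compLinKer (fun _ => symLinKerAt (ctr 4 Lc) Lc) Lc m f₂ (κ₂, (Lc : ℤ) • y + e₂)
            * ∑ α : Fin (3 + 1), (lam (x + unitVec α) - lam x)
                * compVHKer (fun _ => symLinKerAt (ctr 4 Lc) Lc) (fun _ => symVhKerAt (ctr 4 Lc) Lc) Lc m κ₁ ((Lc : ℤ) • y + e₁) f₁ (α, x) := fun f₁ f₂ =>
        summable_sum fun κ₁ _ => summable_sum fun e₁ _ => summable_sum fun κ₂ _ => summable_sum fun e₂ _ => hs2 f₁ f₂ κ₁ e₁ κ₂ e₂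
      have hS5 : Summable fun x : Site (3 + 1) => ∑ κ : Fin (3 + 1), ∑ e ∈ offs Lc, symLinKerAt (ctr 4 Lc) Lc μ y (κ, (Lc : ℤ) • y + e)
            * ∑ α : Fin (3 + 1), (lam (x + unitVec α) - lam x)
                * ((1 / 2 : ℝ) * (compMixKerG (fun _ => symLinKerAt (ctr 4 Lc) Lc) (fun _ => symVhKerAt (ctr 4 Lc) Lc) (fun _ => symHessKerAt (ctr 4 Lc) Lc)
                      (fun _ => symMixKerAt (ctr 4 Lc) Lc) Lc m κ ((Lc : ℤ) • y + e) (α, x) f f'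
                    + compMixKerG (fun _ => symLinKerAt (ctr 4 Lc) Lc) (fun _ => symVhKerAt (ctr 4 Lc) Lc) (fun _ => symHessKerAt (ctr 4 Lc) Lc)
                      (fun _ => symMixKerAt (ctr 4 Lc) Lc) Lc m κ ((Lc : ℤ) • y + e) (α, x) f' f)) :=
        summable_sum fun κ _ => summable_sum fun e _ => hs5 κ e
      rw [tsum_congr hsplit, Summable.tsum_add (hS1.add ((hS2 f f').add (hS2 f' f))) hS5, Summable.tsum_add hS1 ((hS2 f f').add (hS2 f' f)),
        Summable.tsum_add (hS2 f f') (hS2 f' f),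
        Summable.tsum_finsetSum (fun κ _ => summable_sum fun e _ => hs1 κ e), Summable.tsum_finsetSum (fun κ _ => summable_sum fun e _ => hs5 κ e),
        Summable.tsum_finsetSum (fun κ₁ _ => summable_sum fun e₁ _ => summable_sum fun κ₂ _ => summable_sum fun e₂ _ => hs2 f f' κ₁ e₁ κ₂ e₂),
        Summable.tsum_finsetSum (fun κ₁ _ => summable_sum fun e₁ _ => summable_sum fun κ₂ _ => summable_sum fun e₂ _ => hs2 f' f κ₁ e₁ κ₂ e₂)]
      simp only [Summable.tsum_finsetSum (fun e (_ : e ∈ offs Lc) => hs1 _ e), Summable.tsum_finsetSum (fun e (_ : e ∈ offs Lc) => hs5 _ e),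
        Summable.tsum_finsetSum (fun e₁ (_ : e₁ ∈ offs Lc) => summable_sum fun κ₂ _ => summable_sum fun e₂ _ => hs2 _ _ _ e₁ κ₂ e₂),
        Summable.tsum_finsetSum (fun κ₂ _ => summable_sum fun e₂ (_ : e₂ ∈ offs Lc) => hs2 _ _ _ _ κ₂ e₂),
        Summable.tsum_finsetSum (fun e₂ (_ : e₂ ∈ offs Lc) => hs2 _ _ _ _ _ e₂),
        tsum_mul_right, tsum_mul_left]
      -- (W-lin)_m on the S1 legs, (W-vh)_m on the cross legs, the depth-`m` identity on the S5 legs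
      simp only [tsum_sum_grad_mul_compLinKer, tsum_sum_grad_mul_compVHKer, IH]
      -- the top storey (PART 32's computation): expand `C`, move the transporting bond innermost, apply the site law AT LEVEL `m` with `Λ_m := λ ∘ R_m`
      have hT : (∑ κ : Fin (3 + 1), ∑ e ∈ offs Lc,
            (lam (((Lc ^ m : ℕ) : ℤ) • ((Lc : ℤ) • y + e + unitVec κ) + ∑ k ∈ Finset.range m, ((Lc ^ k : ℕ) : ℤ) • ctr 4 Lc)
                - lam (((Lc ^ m : ℕ) : ℤ) • ((Lc : ℤ) • y + e) + ∑ k ∈ Finset.range m, ((Lc ^ k : ℕ) : ℤ) • ctr 4 Lc)) * C κ e)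
          = ∑ κ₁ : Fin (3 + 1), ∑ e₁ ∈ offs Lc, ∑ κ₂ : Fin (3 + 1), ∑ e₂ ∈ offs Lc,
              (lam (((Lc ^ m : ℕ) : ℤ) • ((Lc : ℤ) • y + e₂) + ∑ k ∈ Finset.range m, ((Lc ^ k : ℕ) : ℤ) • ctr 4 Lc)
                  - lam (((Lc ^ m : ℕ) : ℤ) • ((Lc : ℤ) • y + e₁) + ∑ k ∈ Finset.range m, ((Lc ^ k : ℕ) : ℤ) • ctr 4 Lc))
                * symHessKerAt (ctr 4 Lc) Lc μ y (κ₁, (Lc : ℤ) • y + e₁) (κ₂, (Lc : ℤ) • y + e₂)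
                * compLinKer (fun _ => symLinKerAt (ctr 4 Lc) Lc) Lc m f (κ₁, (Lc : ℤ) • y + e₁)
                * compLinKer (fun _ => symLinKerAt (ctr 4 Lc) Lc) Lc m f' (κ₂, (Lc : ℤ) • y + e₂) := by
        simp only [hC, Finset.mul_sum]
        rw [sum6_push2]
        refine Finset.sum_congr rfl fun κ₁ _ => Finset.sum_congr rfl fun e₁ _ => Finset.sum_congr rfl fun κ₂ _ => Finset.sum_congr rfl fun e₂ _ => ?_
        have hA2 := sum_offs_grad_mul_symMixKerAt_even (Lc := Lc)
          (fun v => lam (((Lc ^ m : ℕ) : ℤ) • v + ∑ k ∈ Finset.range m, ((Lc ^ k : ℕ) : ℤ) • ctr 4 Lc)) μ y (κ₁, (Lc : ℤ) • y + e₁) (κ₂, (Lc : ℤ) • y + e₂)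
        beta_reduce at hA2
        have hpull : (∑ κ : Fin (3 + 1), ∑ e ∈ offs Lc,
              (lam (((Lc ^ m : ℕ) : ℤ) • ((Lc : ℤ) • y + e + unitVec κ) + ∑ k ∈ Finset.range m, ((Lc ^ k : ℕ) : ℤ) • ctr 4 Lc)
                  - lam (((Lc ^ m : ℕ) : ℤ) • ((Lc : ℤ) • y + e) + ∑ k ∈ Finset.range m, ((Lc ^ k : ℕ) : ℤ) • ctr 4 Lc))
                * ((1 / 2 : ℝ) * ((symMixKerAt (ctr 4 Lc) Lc μ y (κ, (Lc : ℤ) • y + e) (κ₁, (Lc : ℤ) • y + e₁) (κ₂, (Lc : ℤ) • y + e₂)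
                    + symMixKerAt (ctr 4 Lc) Lc μ y (κ, (Lc : ℤ) • y + e) (κ₂, (Lc : ℤ) • y + e₂) (κ₁, (Lc : ℤ) • y + e₁))
                    * compLinKer (fun _ => symLinKerAt (ctr 4 Lc) Lc) Lc m f (κ₁, (Lc : ℤ) • y + e₁)
                    * compLinKer (fun _ => symLinKerAt (ctr 4 Lc) Lc) Lc m f' (κ₂, (Lc : ℤ) • y + e₂))))
            = (∑ κ : Fin (3 + 1), ∑ e ∈ offs Lc,
                (lam (((Lc ^ m : ℕ) : ℤ) • ((Lc : ℤ) • y + e + unitVec κ) + ∑ k ∈ Finset.range m, ((Lc ^ k : ℕ) : ℤ) • ctr 4 Lc)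
                    - lam (((Lc ^ m : ℕ) : ℤ) • ((Lc : ℤ) • y + e) + ∑ k ∈ Finset.range m, ((Lc ^ k : ℕ) : ℤ) • ctr 4 Lc))
                  * ((1 / 2 : ℝ) * (symMixKerAt (ctr 4 Lc) Lc μ y (κ, (Lc : ℤ) • y + e) (κ₁, (Lc : ℤ) • y + e₁) (κ₂, (Lc : ℤ) • y + e₂)
                    + symMixKerAt (ctr 4 Lc) Lc μ y (κ, (Lc : ℤ) • y + e) (κ₂, (Lc : ℤ) • y + e₂) (κ₁, (Lc : ℤ) • y + e₁))))
                * (compLinKer (fun _ => symLinKerAt (ctr 4 Lc) Lc) Lc m f (κ₁, (Lc : ℤ) • y + e₁)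
                    * compLinKer (fun _ => symLinKerAt (ctr 4 Lc) Lc) Lc m f' (κ₂, (Lc : ℤ) • y + e₂)) := by
          rw [Finset.sum_mul]
          refine Finset.sum_congr rfl fun κ _ => ?_
          rw [Finset.sum_mul]
          refine Finset.sum_congr rfl fun e _ => ?_
          ring
        rw [hpull, hA2]
        ring
      -- the swapped cross row re-indexed (antisymmetry of the top Hessian brick)
      have hX2 := sum4_cross_swap_eq_neg (Lc := Lc)
        (fun κ₁ e₁ => lam (((Lc ^ m : ℕ) : ℤ) • ((Lc : ℤ) • y + e₁) + ∑ k ∈ Finset.range m, ((Lc ^ k : ℕ) : ℤ) • ctr 4 Lc) - lam f'.2) m μ y f f'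
      beta_reduce at hX2
      -- termwise: root-sampled commutator + cross row − swapped cross row = finest commutator of the top Hessian word
      have hsum := sum4_eq_zero_of_add4 (L := Lc)
        (fun κ₁ e₁ κ₂ e₂ => (lam (((Lc ^ m : ℕ) : ℤ) • ((Lc : ℤ) • y + e₂) + ∑ k ∈ Finset.range m, ((Lc ^ k : ℕ) : ℤ) • ctr 4 Lc)
              - lam (((Lc ^ m : ℕ) : ℤ) • ((Lc : ℤ) • y + e₁) + ∑ k ∈ Finset.range m, ((Lc ^ k : ℕ) : ℤ) • ctr 4 Lc))
            * symHessKerAt (ctr 4 Lc) Lc μ y (κ₁, (Lc : ℤ) • y + e₁) (κ₂, (Lc : ℤ) • y + e₂)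
            * compLinKer (fun _ => symLinKerAt (ctr 4 Lc) Lc) Lc m f (κ₁, (Lc : ℤ) • y + e₁)
            * compLinKer (fun _ => symLinKerAt (ctr 4 Lc) Lc) Lc m f' (κ₂, (Lc : ℤ) • y + e₂))
        (fun κ₁ e₁ κ₂ e₂ => symHessKerAt (ctr 4 Lc) Lc μ y (κ₁, (Lc : ℤ) • y + e₁) (κ₂, (Lc : ℤ) • y + e₂)
            * compLinKer (fun _ => symLinKerAt (ctr 4 Lc) Lc) Lc m f' (κ₂, (Lc : ℤ) • y + e₂)
            * ((lam (((Lc ^ m : ℕ) : ℤ) • ((Lc : ℤ) • y + e₁) + ∑ k ∈ Finset.range m, ((Lc ^ k : ℕ) : ℤ) • ctr 4 Lc) - lam f.2)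
                * compLinKer (fun _ => symLinKerAt (ctr 4 Lc) Lc) Lc m f (κ₁, (Lc : ℤ) • y + e₁)))
        (fun κ₁ e₁ κ₂ e₂ => -(symHessKerAt (ctr 4 Lc) Lc μ y (κ₁, (Lc : ℤ) • y + e₁) (κ₂, (Lc : ℤ) • y + e₂)
            * compLinKer (fun _ => symLinKerAt (ctr 4 Lc) Lc) Lc m f (κ₁, (Lc : ℤ) • y + e₁)
            * compLinKer (fun _ => symLinKerAt (ctr 4 Lc) Lc) Lc m f' (κ₂, (Lc : ℤ) • y + e₂)
            * (lam (((Lc ^ m : ℕ) : ℤ) • ((Lc : ℤ) • y + e₂) + ∑ k ∈ Finset.range m, ((Lc ^ k : ℕ) : ℤ) • ctr 4 Lc) - lam f'.2)))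
        (fun κ₁ e₁ κ₂ e₂ => -((lam f'.2 - lam f.2) * (symHessKerAt (ctr 4 Lc) Lc μ y (κ₁, (Lc : ℤ) • y + e₁) (κ₂, (Lc : ℤ) • y + e₂)
            * compLinKer (fun _ => symLinKerAt (ctr 4 Lc) Lc) Lc m f (κ₁, (Lc : ℤ) • y + e₁)
            * compLinKer (fun _ => symLinKerAt (ctr 4 Lc) Lc) Lc m f' (κ₂, (Lc : ℤ) • y + e₂))))
        (fun κ₁ e₁ κ₂ e₂ => by ring)
      simp only [Finset.sum_neg_distrib, ← Finset.mul_sum] at hsum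
      rw [compVHKer_succ, mul_add]
      congr 1
      · rw [hT, hX2]
        linear_combination hsum
      · rw [Finset.mul_sum]
        refine Finset.sum_congr rfl fun κ _ => ?_
        rw [Finset.mul_sum]
        refine Finset.sum_congr rfl fun e _ => ?_
        ring

end Summit.QuantumFields.BalabanUV.Beta.CombMixedT2EvenGradedRec

end
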